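import Summits.HubbardSuperconductivity.HubbardSuperconductivity.Theorems.AnisotropyChordTransferFibre3B1Bracket
import Summits.HubbardSuperconductivity.HubbardSuperconductivity.Theorems.AnisotropyChordTransferFibre3KernelHarmonicity

/-!
# Route `AnisotropyChord` / H0 rotor rung, LEVEL 2 family B1: ready-to-cite INSTANCES of the generic L-uniform bracket

`…Fibre3B1Bracket` proves `b1Bracket` for arbitrary finite products of shifted propagator powers.  This file spells out the
forms the Level-2 rows cite directly (memo ROTOR-THEORY-21 §311(b), LEVEL2-SPEC §3 row B1):
* `scales_of_L0` / `b1Bracket_L0` — the `L₀`-form of the scales: `θ₀ = 2π/L₀`, `K = L₀/4` serve EVERY `L ≥ L₀`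
  (PartN35's convention for `S2UniformBracket`);
* `b1Bracket_pow` — ONE factor, `Σ_k g(k)ⁿ` (`n ≥ 2`; `n = 2` is `S₂`, cf. `s2UniformBracket_holds`):
  `Σ_{p ∈ zWindow K} (|p|² − ν)^{−n} ≤ θ^{2n} Σ_k g(k)ⁿ ≤ Σ_{p ∈ zWindow K} (W_{θ₀}(p) − ν)^{−n} + tailConst ν K n`;
* `b1Bracket_two` — TWO factors, `Σ_k g(k)^a g(k + t)^b` (`a, b ≥ 1`, `|t|∞ ≤ S`; the `Σ g^a g(·+K₁)^b` of the `B`-term and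
  the convolutions `t(q) = Σ_p g(p) g(q − p) = Σ_p g(p) g(p − q)`), index set `{p ∈ zWindow K : p + t ∈ zWindow K}`;
* `gres_neg` (evenness, from `epsT_neg` of `…Fibre3KernelHarmonicity`), `toTor_neg`, `conv_eq_shift`, `conv_eq_shift_intCast` — the convolution
  `Σ_p g(p) g(q − p)` IS the two-factor sum with shift `−q`.
Prover seat `hubbard-h0-rotor-p2` g4; helper for piece A = stmt-HubbardSuperconductivity-23918 of rung 19089
(`--supports`, helper class).  Nothing here proves superconductivity in the Hubbard model; helper lemmas of ONE conditional
reduction (the GM₃ ∀L certificate, Level-2 rows); the rotor TARGET as originally worded stays FALSE (g15 verdict).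
Mathlib + the tree only; no sorry.
-/

set_option linter.dupNamespace false
set_option autoImplicit false

noncomputable section

open scoped BigOperators

namespace Summit.HubbardSuperconductivity.HubbardSuperconductivity.Theorems.AnisotropyChord.Transfer.Fibre3.B1

variable (L : ℕ) [NeZero L]

/-! ## The `L₀`-form of the scales -/

omit [NeZero L] in
/-- for `L ≥ L₀ > 0`: `2π/L ≤ 2π/L₀` and `(2π/L₀)·⌊L₀/4⌋ ≤ π/2`. [folklore] -/
theorem scales_of_L0 (L0 : ℕ) (hL0pos : 0 < L0) (hL0 : L0 ≤ L) :
    2 * Real.pi / L ≤ 2 * Real.pi / L0 ∧ 2 * Real.pi / L0 * ((L0 / 4 : ℕ) : ℝ) ≤ Real.pi / 2 := by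
  have hpi := Real.pi_pos
  have hL0R : (0 : ℝ) < L0 := by exact_mod_cast hL0pos
  have hL0L : (L0 : ℝ) ≤ L := by exact_mod_cast hL0
  refine ⟨div_le_div_of_nonneg_left (by positivity) hL0R hL0L, ?_⟩
  have h4 : (((L0 / 4 : ℕ)) : ℝ) * 4 ≤ L0 := by exact_mod_cast Nat.div_mul_le_self L0 4
  rw [div_mul_eq_mul_div, div_le_iff₀ hL0R]
  nlinarith

variable {ι : Type*} [Fintype ι]

/-- **`b1Bracket` in `L₀`-form**: for every `L ≥ L₀`, with `K = L₀/4 ≥ 2 + 2S` and `θ₀ = 2π/L₀`. -/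
theorem b1Bracket_L0 (L0 : ℕ) (hL0 : L0 ≤ L) (S : ℕ) (hK : 2 + 2 * S ≤ L0 / 4)
    (s : ι → ℤ × ℤ) (a : ι → ℕ) (n : ℕ) (ha : ∀ i, 1 ≤ a i) (hn : ∑ i, a i = n) (h2 : 2 ≤ n)
    (hS : ∀ i, (s i).1.natAbs ≤ S ∧ (s i).2.natAbs ≤ S)
    (ν : ℝ) (hν0 : 0 ≤ ν) (hν : ν < 4 / Real.pi ^ 2) :
    loSum ν (L0 / 4) S s a ≤ (2 * Real.pi / L) ^ (2 * n) * torSum L (ν * (2 * Real.pi / L) ^ 2) s a ∧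
      (2 * Real.pi / L) ^ (2 * n) * torSum L (ν * (2 * Real.pi / L) ^ 2) s a
        ≤ hiSum ν (2 * Real.pi / L0) (L0 / 4) S s a + tailConst ν (L0 / 4 - 2 * S) n := by
  have hL0pos : 0 < L0 := by omega
  obtain ⟨h1, h2'⟩ := scales_of_L0 L L0 hL0pos hL0
  exact b1Bracket L (2 * Real.pi / L0) (L0 / 4) S s a n ha hn h2 hS hK h1 h2' ν hν0 hν

/-! ## One factor: `Σ_k g(k)ⁿ` -/

omit [NeZero L] in
/-- `toTor (0,0) = 0`. [folklore] -/
theorem toTor_zero : toTor L (0 : ℤ × ℤ) = 0 := by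
  unfold toTor
  simp

/-- the index set with no shift is the punctured window. [folklore] -/
theorem idx_const_zero (K : ℕ) {κ : Type*} [Fintype κ] [Nonempty κ] :
    idx K 0 (fun _ : κ => (0 : ℤ × ℤ)) = zWindow K := by
  ext p
  rw [mem_idx_iff, mem_box_iff]
  constructor
  · rintro ⟨-, h⟩
    have := h (Classical.arbitrary κ)
    simpa using this
  · intro hp
    have hp' := hp
    rw [mem_zWindow_iff] at hp'
    refine ⟨?_, fun _ => by simpa using hp⟩
    push_cast
    omega

/-- **ONE FACTOR (`S_n`-type sums, `n ≥ 2`)**: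
`Σ_{p ∈ zWindow K} (|p|² − ν)^{−n} ≤ θ^{2n}·Σ_k g(k)ⁿ ≤ Σ_{p ∈ zWindow K} (W_{θ₀}(p) − ν)^{−n} + tailConst ν K n`. -/
theorem b1Bracket_pow (θ0 : ℝ) (K n : ℕ) (h2 : 2 ≤ n) (hK : 2 ≤ K)
    (hθ0 : 2 * Real.pi / L ≤ θ0) (hθ0K : θ0 * K ≤ Real.pi / 2)
    (ν : ℝ) (hν0 : 0 ≤ ν) (hν : ν < 4 / Real.pi ^ 2) :
    ∑ p ∈ zWindow K, (1 / (nsq p - ν)) ^ n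
        ≤ (2 * Real.pi / L) ^ (2 * n) * ∑ k : Tor L, gres L (ν * (2 * Real.pi / L) ^ 2) k ^ n ∧
      (2 * Real.pi / L) ^ (2 * n) * ∑ k : Tor L, gres L (ν * (2 * Real.pi / L) ^ 2) k ^ n
        ≤ ∑ p ∈ zWindow K, (1 / (winE θ0 p - ν)) ^ n + tailConst ν K n := by
  have h := b1Bracket L θ0 K 0 (fun _ : Fin 1 => (0 : ℤ × ℤ)) (fun _ => n) n
    (fun _ => by omega) (by simp) h2 (fun _ => by simp) (by omega) hθ0 hθ0K ν hν0 hν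
  have e1 : loSum ν K 0 (fun _ : Fin 1 => (0 : ℤ × ℤ)) (fun _ => n)
      = ∑ p ∈ zWindow K, (1 / (nsq p - ν)) ^ n := by
    unfold loSum
    rw [idx_const_zero]
    refine Finset.sum_congr rfl fun p _ => ?_
    simp
  have e2 : hiSum ν θ0 K 0 (fun _ : Fin 1 => (0 : ℤ × ℤ)) (fun _ => n)
      = ∑ p ∈ zWindow K, (1 / (winE θ0 p - ν)) ^ n := by
    unfold hiSum
    rw [idx_const_zero]
    refine Finset.sum_congr rfl fun p _ => ?_
    simp
  have e3 : torSum L (ν * (2 * Real.pi / L) ^ 2) (fun _ : Fin 1 => (0 : ℤ × ℤ)) (fun _ => n)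
      = ∑ k : Tor L, gres L (ν * (2 * Real.pi / L) ^ 2) k ^ n := by
    unfold torSum
    refine Finset.sum_congr rfl fun k _ => ?_
    simp [toTor_zero]
  rw [e1, e2, e3, Nat.mul_zero, Nat.sub_zero] at h
  exact h

/-! ## Two factors: `Σ_k g(k)^a g(k + t)^b` -/

/-- the index set with shifts `(0, t)` is `{p ∈ zWindow K : p + t ∈ zWindow K}`. [folklore] -/
theorem idx_two (K S : ℕ) (t : ℤ × ℤ) :
    idx K S ![(0 : ℤ × ℤ), t] = (zWindow K).filter (fun p => p + t ∈ zWindow K) := by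
  ext p
  rw [mem_idx_iff, mem_box_iff, Finset.mem_filter, Fin.forall_fin_two]
  simp only [Matrix.cons_val_zero, Matrix.cons_val_one, add_zero]
  constructor
  · rintro ⟨-, h0, h1⟩
    exact ⟨h0, h1⟩
  · rintro ⟨h0, h1⟩
    have hp' := h0
    rw [mem_zWindow_iff] at hp'
    refine ⟨?_, h0, h1⟩
    push_cast
    omega

/-- **TWO FACTORS**: for `|t|∞ ≤ S`, `a, b ≥ 1`, `2 + 2S ≤ K`, `θ = 2π/L ≤ θ₀`, `θ₀K ≤ π/2`, `0 ≤ ν < 4/π²`: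
`Σ_{p ∈ zWindow K, p+t ∈ zWindow K} (|p|²−ν)^{−a}(|p+t|²−ν)^{−b} ≤ θ^{2(a+b)} Σ_k g(k)^a g(k+t)^b
  ≤ Σ_{same p} (W_{θ₀}(p)−ν)^{−a}(W_{θ₀}(p+t)−ν)^{−b} + tailConst ν (K − 2S) (a+b)`. -/
theorem b1Bracket_two (θ0 : ℝ) (K S : ℕ) (t : ℤ × ℤ) (ht : t.1.natAbs ≤ S ∧ t.2.natAbs ≤ S)
    (a b : ℕ) (ha : 1 ≤ a) (hb : 1 ≤ b) (hK : 2 + 2 * S ≤ K)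
    (hθ0 : 2 * Real.pi / L ≤ θ0) (hθ0K : θ0 * K ≤ Real.pi / 2)
    (ν : ℝ) (hν0 : 0 ≤ ν) (hν : ν < 4 / Real.pi ^ 2) :
    ∑ p ∈ (zWindow K).filter (fun p => p + t ∈ zWindow K),
          (1 / (nsq p - ν)) ^ a * (1 / (nsq (p + t) - ν)) ^ b
        ≤ (2 * Real.pi / L) ^ (2 * (a + b)) * ∑ k : Tor L,
            gres L (ν * (2 * Real.pi / L) ^ 2) k ^ a * gres L (ν * (2 * Real.pi / L) ^ 2) (k + toTor L t) ^ b ∧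
      (2 * Real.pi / L) ^ (2 * (a + b)) * ∑ k : Tor L,
            gres L (ν * (2 * Real.pi / L) ^ 2) k ^ a * gres L (ν * (2 * Real.pi / L) ^ 2) (k + toTor L t) ^ b
        ≤ ∑ p ∈ (zWindow K).filter (fun p => p + t ∈ zWindow K),
            (1 / (winE θ0 p - ν)) ^ a * (1 / (winE θ0 (p + t) - ν)) ^ b + tailConst ν (K - 2 * S) (a + b) := by
  have h := b1Bracket L θ0 K S ![(0 : ℤ × ℤ), t] ![a, b] (a + b)
    (by rw [Fin.forall_fin_two]; simp; omega) (by rw [Fin.sum_univ_two]; simp) (by omega)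
    (by rw [Fin.forall_fin_two]; simp; exact ht) hK hθ0 hθ0K ν hν0 hν
  have e1 : loSum ν K S ![(0 : ℤ × ℤ), t] ![a, b]
      = ∑ p ∈ (zWindow K).filter (fun p => p + t ∈ zWindow K),
          (1 / (nsq p - ν)) ^ a * (1 / (nsq (p + t) - ν)) ^ b := by
    unfold loSum
    rw [idx_two]
    refine Finset.sum_congr rfl fun p _ => ?_
    rw [Fin.prod_univ_two]
    simp
  have e2 : hiSum ν θ0 K S ![(0 : ℤ × ℤ), t] ![a, b]
      = ∑ p ∈ (zWindow K).filter (fun p => p + t ∈ zWindow K),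
          (1 / (winE θ0 p - ν)) ^ a * (1 / (winE θ0 (p + t) - ν)) ^ b := by
    unfold hiSum
    rw [idx_two]
    refine Finset.sum_congr rfl fun p _ => ?_
    rw [Fin.prod_univ_two]
    simp
  have e3 : torSum L (ν * (2 * Real.pi / L) ^ 2) ![(0 : ℤ × ℤ), t] ![a, b]
      = ∑ k : Tor L, gres L (ν * (2 * Real.pi / L) ^ 2) k ^ a
          * gres L (ν * (2 * Real.pi / L) ^ 2) (k + toTor L t) ^ b := by
    unfold torSum
    refine Finset.sum_congr rfl fun k _ => ?_
    rw [Fin.prod_univ_two]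
    simp [toTor_zero]
  rw [e1, e2, e3] at h
  exact h

/-! ## Evenness of the propagator and the convolution form of `t(q)` -/

/-- the propagator is even: `g(−k) = g(k)` (`epsT_neg`, `…Fibre3KernelHarmonicity`). [folklore] -/
theorem gres_neg (lam : ℝ) (k : Tor L) : gres L lam (-k) = gres L lam k := by
  unfold gres
  rw [epsT_neg]
  simp only [neg_eq_zero]

omit [NeZero L] in
/-- `toTor (−t) = −toTor t`. [folklore] -/
theorem toTor_neg (t : ℤ × ℤ) : toTor L (-t) = -toTor L t := by
  unfold toTor
  ext <;> simp

/-- the CONVOLUTION FORM of the memo's `t(q)`: `Σ_p g(p)·g(q − p) = Σ_p g(p)·g(p + (−q))` — a two-factor B1 sum with shift `−q`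
(so `b1Bracket_two` with `t = −q` brackets it). [folklore] -/
theorem conv_eq_shift (lam : ℝ) (q : Tor L) :
    ∑ p : Tor L, gres L lam p * gres L lam (q - p) = ∑ p : Tor L, gres L lam p * gres L lam (p + -q) := by
  refine Finset.sum_congr rfl fun p _ => ?_
  rw [← gres_neg L lam (q - p), neg_sub, sub_eq_add_neg]

/-- the convolution at an integer momentum `q`, as the two-factor B1 sum with shift `−q`. [folklore] -/
theorem conv_eq_shift_intCast (lam : ℝ) (q : ℤ × ℤ) :
    ∑ p : Tor L, gres L lam p * gres L lam (toTor L q - p)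
      = ∑ p : Tor L, gres L lam p * gres L lam (p + toTor L (-q)) := by
  rw [conv_eq_shift, toTor_neg]

end Summit.HubbardSuperconductivity.HubbardSuperconductivity.Theorems.AnisotropyChord.Transfer.Fibre3.B1

end
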